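import Summits.HubbardSuperconductivity.HubbardSuperconductivity.Theorems.EnslavedA1gPairChemicalPotentialWindow
import Literature.MathematicalPhysics.QuantumLattice.HubbardSzSectorLadder
import Literature.MathematicalPhysics.QuantumLattice.HubbardOneParticleCost
import HarnessLib

/-!
# Crux `MesoscopicPairOrder` (item `stmt-HubbardSuperconductivity-7331`), line `SketchIdeator4` —
# stub `stub_pairAdditionBound` (the density-weighted two-electron ADDITION bound)

Helper file (lands `--supports stmt-HubbardSuperconductivity-7331`; the composition lives in the
lead's skeleton `Cruxes/MesoscopicPairOrder/Lines/SketchIdeator4.lean`, route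
`FunctionFieldCertificate`). Objects: the pure Hubbard Hamiltonian
`H = hubbardTorus 2 L 1 U = hamiltonian (fermionTorusGraph 2 L) 1 U` on the fermionic torus
`(ℤ/Lℤ)²`, Lieb's sectors `(N↑, N↓) = (a, b)` (`IsInSector a b`) and the joint sectors
`szSector N M` with sector energies `E(N, M) = H.minEnergyOn (szSector N M)`; we write `E(N, 0)`
for the `S^z = 0` sectors.

This is the mirror image (one-particle ADDITION instead of removal) of the tree's
`EnslavedA1g.sum_re_expect_annihilation_le` / `le_of_removal_bound` / `minEnergyOn_pairRemoved_le`: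

* `hamiltonian_mul_creation` — `H c†_{zτ} = c†_{zτ} H - t Σ_{y∼z} c†_{yτ} + U c†_{zτ} n_{zτ̄}`
  (adjoint of the tree's `[H, c_{zτ}] = t Σ_{y∼z} c_{yτ} - U n_{zτ̄} c_{zτ}`);
* `sum_norm_creation_mulVec` — `Σ_x ‖c†_{xσ}ψ‖² = |Λ|‖ψ‖² - ⟨ψ, N_σ ψ⟩` (CAR `c c† = 1 - c†c`);
* `sum_re_expect_creation_le` — on a graph of maximal degree `≤ Δ`, for `U ≥ 0` and `Hφ = Eφ`:
  `Σ_z Re⟨c†_{zτ}φ, H c†_{zτ}φ⟩ ≤ E Σ_z ‖c†_{zτ}φ‖² + Δ|t| Σ_z ‖c_{zτ}φ‖² + U Σ_z ‖c_{zτ̄}φ‖²`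
  (hopping part: `⟨c†_zφ, c†_yφ⟩ = -⟨c_yφ, c_zφ⟩` for `y ≠ z`, bounded by polarization and degree
  counting against the ANNIHILATION norms; interaction part:
  `Re⟨c†_zφ, c†_z n_{zτ̄}φ⟩ = ⟨φ, n_{zτ̄}φ⟩ - ‖c_{zτ̄}c_{zτ}φ‖² ≤ ‖c_{zτ̄}φ‖²`);
* `le_of_addition_bound` — with the homogeneous variational bound `E'‖c†_zφ‖² ≤ Re⟨c†_zφ, Hc†_zφ⟩`
  in the upper sector: `E' ≤ E + (Δ|t| B + U C)/A` (`A, B, C` the three sums, `A > 0`);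
* `stub_pairAdditionBound` — the registered stub: for `U ≥ 0`, `2n + 2 ≤ L²`,
  `E(2n+2, 0) ≤ E(2n, 0) + (8n + U(2n+1))/(L² - n)`: add an `↑` electron to a ground state of the
  sector `(n, n)` (`A = (L² - n)‖φ‖²`, `B = C = n‖φ‖²`:
  `E(n+1,n) ≤ E(2n,0) + (4n + Un)/(L² - n)`), then a `↓` electron to a ground state of `(n+1, n)`
  (`A = (L² - n)‖φ‖²`, `B = n‖φ‖²`, `C = (n+1)‖φ‖²`).

Sources: H. Tasaki, *Physics and Mathematics of Quantum Many-Body Systems* (2020) §2.1 (variational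
principle); E. H. Lieb, PRL 62 (1989) 1201 (sectors); F. H. L. Essler et al., *The One-Dimensional
Hubbard Model* (2005) §2.1–2.2 (CAR identities); D. Ruelle, *Statistical Mechanics* (1969) §3.4 (the
classical a priori density bounds). The computation ("Euler identity"
`Σ_z c_{zσ}[H, c†_{zσ}] = -T_σ + U Σ_z n_{zσ̄}(1 - n_{zσ})`) is folklore; no definition is
introduced.
-/

noncomputable section

-- the summit namespace repeats the problem name by design (D-0017)
set_option linter.dupNamespace false

namespace Summit.HubbardSuperconductivity.HubbardSuperconductivity.Theorems.FunctionFieldCertificate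

open Matrix Finset
open Literature.Probability.LatticeModels Literature.MathematicalPhysics.QuantumLattice
open Literature.MathematicalPhysics.QuantumLattice.EigenvalueContinuation
  (re_star_dotProduct_self_nonneg re_star_dotProduct_self_pos)
open Literature.MathematicalPhysics.QuantumLattice.ThermodynamicLimit (star_mulVec_dotProduct)
open Summit.HubbardSuperconductivity.TwTipContinuation.IsogapTransport
  (sum_numberOp_up_mulVec sum_numberOp_down_mulVec)
open Summit.HubbardSuperconductivity.HubbardSuperconductivity.Theorems.EnslavedA1g
  (two_mul_abs_re_dot_le sum_norm_annihilation_mulVec hamiltonian_commutator_annihilation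
    numberOp_mul_annihilation_of_ne)
open scoped ComplexOrder

/-! ### The one-particle addition bound on a finite graph -/

section Addition

variable {Λ : Type*} [LinearOrder Λ] [Fintype Λ] (G : SimpleGraph Λ) [DecidableRel G.Adj]

/-- **`H c†_{zτ} = c†_{zτ} H - t Σ_{y ∼ z} c†_{yτ} + U c†_{zτ} n_{zτ̄}`** for the Hubbard
Hamiltonian on any finite graph: the adjoint of the tree's
`[H(t,U), c_{zτ}] = t Σ_{y∼z} c_{yτ} - U n_{zτ̄} c_{zτ}`
(`EnslavedA1g.hamiltonian_commutator_annihilation`), `H` being Hermitian. Essler et al. (2005)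
§2.2. [folklore] -/
theorem hamiltonian_mul_creation (t U : ℝ) (z : Λ) {τ τ' : Fin 2} (hne : τ' ≠ τ) :
    hamiltonian G t U * creation (orb z τ) =
      creation (orb z τ) * hamiltonian G t U -
          (t : ℂ) • (∑ y ∈ univ.filter (fun y => G.Adj z y), creation (orb y τ)) +
        (U : ℂ) • (creation (orb z τ) * numberOp z τ') := by
  have h0 := hamiltonian_commutator_annihilation G t U z hne
  have hH : (hamiltonian G t U)ᴴ = hamiltonian G t U := (LiebThm1.hamiltonian_isHermitian G t U).eq
  have hn : (numberOp z τ' : Matrix (Finset (Orb Λ)) (Finset (Orb Λ)) ℂ)ᴴ = numberOp z τ' := by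
    rw [numberOp, conjTranspose_mul, creation_conjTranspose, annihilation_conjTranspose]
  have h1 := congrArg conjTranspose h0
  simp only [conjTranspose_sub, conjTranspose_mul, conjTranspose_smul, conjTranspose_sum, hH, hn,
    annihilation_conjTranspose, Complex.star_def, Complex.conj_ofReal] at h1
  -- `h1 : c† H - H c† = t Σ c†_y - U c† n`
  rw [sub_eq_iff_eq_add] at h1
  rw [h1]
  abel

/-- `Σ_x ‖c†_{xσ} ψ‖² = |Λ| ‖ψ‖² - ⟨ψ, (Σ_x n_{xσ}) ψ⟩` (CAR: `c_{xσ} c†_{xσ} = 1 - n_{xσ}`).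
Essler et al. (2005) §2.1, eq. (2.2b). [folklore] -/
theorem sum_norm_creation_mulVec (σ : Fin 2) (ψ : Fock (Orb Λ)) :
    ∑ x : Λ, star (creation (orb x σ) *ᵥ ψ) ⬝ᵥ (creation (orb x σ) *ᵥ ψ) =
      (Fintype.card Λ : ℂ) * (star ψ ⬝ᵥ ψ) - star ψ ⬝ᵥ ((∑ x : Λ, numberOp x σ) *ᵥ ψ) := by
  have hx : ∀ x : Λ, star (creation (orb x σ) *ᵥ ψ) ⬝ᵥ (creation (orb x σ) *ᵥ ψ) =
      star ψ ⬝ᵥ ψ - star ψ ⬝ᵥ (numberOp x σ *ᵥ ψ) := by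
    intro x
    rw [← LiebThm1.star_dotProduct_conjTranspose_mul_mulVec, creation_conjTranspose,
      annihilation_mul_creation, if_pos rfl,
      show creation (orb x σ) * annihilation (orb x σ) = numberOp x σ from rfl, sub_mulVec,
      one_mulVec, dotProduct_sub]
  simp only [hx]
  rw [Finset.sum_sub_distrib, Finset.sum_const, Finset.card_univ, nsmul_eq_mul, ← dotProduct_sum,
    ← sum_mulVec]

/-- **Euler-identity bound for one-particle ADDITION.** On a graph of maximal degree `≤ Δ`, for
`U ≥ 0` and an eigenvector `H φ = E φ` of the Hubbard Hamiltonian: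
`Σ_z Re ⟨c†_{zτ}φ, H c†_{zτ}φ⟩ ≤ E Σ_z ‖c†_{zτ}φ‖² + Δ|t| Σ_z ‖c_{zτ}φ‖² + U Σ_z ‖c_{zτ̄}φ‖²`.
Indeed `⟨c†_zφ, H c†_zφ⟩ = E‖c†_zφ‖² + ⟨c†_zφ, [H, c†_z]φ⟩`; the hopping part is
`-t Σ_{y∼z} ⟨c†_zφ, c†_yφ⟩ = t Σ_{y∼z} ⟨c_yφ, c_zφ⟩` (`c_z c†_y = -c†_y c_z` for `y ≠ z`), at most
`|t| Σ_{y∼z} (‖c_zφ‖² + ‖c_yφ‖²)/2`; the interaction part is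
`U ⟨φ, (1 - n_{zτ}) n_{zτ̄} φ⟩ = U (‖c_{zτ̄}φ‖² - ‖c_{zτ̄} c_{zτ} φ‖²) ≤ U ‖c_{zτ̄}φ‖²`.
Tasaki (2020) §2.1; Ruelle (1969) §3.4; folklore. [folklore] -/
theorem sum_re_expect_creation_le {Δ : ℕ}
    (hΔ : ∀ x : Λ, (Finset.univ.filter fun y => G.Adj x y).card ≤ Δ) (t : ℝ) {U : ℝ} (hU : 0 ≤ U)
    {τ τ' : Fin 2} (hne : τ' ≠ τ) {E : ℝ} {φ : Fock (Orb Λ)}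
    (hφ : hamiltonian G t U *ᵥ φ = (E : ℂ) • φ) :
    ∑ z : Λ, (expect (hamiltonian G t U) (creation (orb z τ) *ᵥ φ)).re ≤
      E * ∑ z : Λ, (star (creation (orb z τ) *ᵥ φ) ⬝ᵥ (creation (orb z τ) *ᵥ φ)).re +
        Δ * |t| *
          ∑ z : Λ, (star (annihilation (orb z τ) *ᵥ φ) ⬝ᵥ (annihilation (orb z τ) *ᵥ φ)).re +
        U * ∑ z : Λ,
          (star (annihilation (orb z τ') *ᵥ φ) ⬝ᵥ (annihilation (orb z τ') *ᵥ φ)).re := by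
  set d : Λ → Fock (Orb Λ) := fun z => creation (orb z τ) *ᵥ φ with hd
  set c : Λ → Fock (Orb Λ) := fun z => annihilation (orb z τ) *ᵥ φ with hc
  set w : Λ → ℝ := fun z => (star (d z) ⬝ᵥ d z).re with hw
  set a : Λ → ℝ := fun z => (star (c z) ⬝ᵥ c z).re with ha
  set b : Λ → ℝ := fun z =>
    (star (annihilation (orb z τ') *ᵥ φ) ⬝ᵥ (annihilation (orb z τ') *ᵥ φ)).re with hb
  set q : Λ → ℝ := fun z =>
    (star (annihilation (orb z τ') *ᵥ c z) ⬝ᵥ (annihilation (orb z τ') *ᵥ c z)).re with hq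
  set F : Λ → Finset Λ := fun z => Finset.univ.filter fun y => G.Adj z y with hF
  have ha0 : ∀ z, 0 ≤ a z := fun z => re_star_dotProduct_self_nonneg _
  have hq0 : ∀ z, 0 ≤ q z := fun z => re_star_dotProduct_self_nonneg _
  -- `H c†_z φ = E c†_z φ - t Σ_{y ∼ z} c†_y φ + U c†_z n_{zτ'} φ`
  have hHd : ∀ z, hamiltonian G t U *ᵥ d z =
      (E : ℂ) • d z - (t : ℂ) • (∑ y ∈ F z, d y) +
        (U : ℂ) • (creation (orb z τ) *ᵥ (numberOp z τ' *ᵥ φ)) := by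
    intro z
    show hamiltonian G t U *ᵥ (creation (orb z τ) *ᵥ φ) = _
    rw [mulVec_mulVec, hamiltonian_mul_creation G t U z hne, add_mulVec, sub_mulVec, smul_mulVec,
      smul_mulVec, sum_mulVec, ← mulVec_mulVec, hφ, mulVec_smul, ← mulVec_mulVec]
  -- hopping matrix elements: `⟨c†_z φ, c†_y φ⟩ = -⟨c_y φ, c_z φ⟩` for `y ∼ z`
  have hhop : ∀ z, ∀ y ∈ F z, star (d z) ⬝ᵥ d y = -(star (c y) ⬝ᵥ c z) := by
    intro z y hy
    have hzy : G.Adj z y := by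
      simp only [hF, Finset.mem_filter, Finset.mem_univ, true_and] at hy
      exact hy
    have hne' : orb z τ ≠ orb y τ := fun h => (G.ne_of_adj hzy) (orb_eq_orb_iff.1 h).1
    show star (creation (orb z τ) *ᵥ φ) ⬝ᵥ (creation (orb y τ) *ᵥ φ) =
      -(star (annihilation (orb y τ) *ᵥ φ) ⬝ᵥ (annihilation (orb z τ) *ᵥ φ))
    rw [star_mulVec_dotProduct, creation_conjTranspose, mulVec_mulVec, annihilation_mul_creation,
      if_neg hne', zero_sub, neg_mulVec, dotProduct_neg, ← mulVec_mulVec,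
      ← annihilation_conjTranspose, ← star_mulVec_dotProduct]
  have hhop' : ∀ z, star (d z) ⬝ᵥ (∑ y ∈ F z, d y) = -∑ y ∈ F z, star (c y) ⬝ᵥ c z := by
    intro z
    rw [dotProduct_sum, ← Finset.sum_neg_distrib]
    exact Finset.sum_congr rfl (hhop z)
  -- interaction matrix element: `⟨c†_z φ, c†_z n_{zτ'} φ⟩ = ‖c_{zτ'} φ‖² - ‖c_{zτ'} c_{zτ} φ‖²`
  have hint : ∀ z, star (d z) ⬝ᵥ (creation (orb z τ) *ᵥ (numberOp z τ' *ᵥ φ)) =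
      star (annihilation (orb z τ') *ᵥ φ) ⬝ᵥ (annihilation (orb z τ') *ᵥ φ) -
        star (annihilation (orb z τ') *ᵥ c z) ⬝ᵥ (annihilation (orb z τ') *ᵥ c z) := by
    intro z
    have hcomm : numberOp z τ' * annihilation (orb z τ) = annihilation (orb z τ) * numberOp z τ' :=
      numberOp_mul_annihilation_of_ne fun h => hne (orb_eq_orb_iff.1 h).2
    have hmat : numberOp z τ * numberOp z τ' =
        creation (orb z τ) * (numberOp z τ' * annihilation (orb z τ)) := by
      rw [hcomm, ← Matrix.mul_assoc]
      rfl
    have h1 : star φ ⬝ᵥ (numberOp z τ' *ᵥ φ) =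
        star (annihilation (orb z τ') *ᵥ φ) ⬝ᵥ (annihilation (orb z τ') *ᵥ φ) := by
      rw [← LiebThm1.star_dotProduct_conjTranspose_mul_mulVec, annihilation_conjTranspose]
      rfl
    have h2 : star φ ⬝ᵥ (numberOp z τ *ᵥ (numberOp z τ' *ᵥ φ)) =
        star (annihilation (orb z τ') *ᵥ c z) ⬝ᵥ (annihilation (orb z τ') *ᵥ c z) := by
      rw [mulVec_mulVec, hmat, ← mulVec_mulVec, ← mulVec_mulVec, ← annihilation_conjTranspose,
        ← star_mulVec_dotProduct, ← LiebThm1.star_dotProduct_conjTranspose_mul_mulVec,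
        annihilation_conjTranspose]
      rfl
    show star (creation (orb z τ) *ᵥ φ) ⬝ᵥ (creation (orb z τ) *ᵥ (numberOp z τ' *ᵥ φ)) = _
    rw [star_mulVec_dotProduct, creation_conjTranspose, mulVec_mulVec, annihilation_mul_creation,
      if_pos rfl, show creation (orb z τ) * annihilation (orb z τ) = numberOp z τ from rfl,
      sub_mulVec, one_mulVec, dotProduct_sub, h1, h2]
  -- the pointwise identity for `Re ⟨c†_z φ, H c†_z φ⟩`
  have hpt : ∀ z, (expect (hamiltonian G t U) (d z)).re =
      E * w z + t * ∑ y ∈ F z, (star (c y) ⬝ᵥ c z).re + U * (b z - q z) := by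
    intro z
    rw [Literature.MathematicalPhysics.QuantumLattice.expect, hHd z, dotProduct_add, dotProduct_sub,
      dotProduct_smul, dotProduct_smul, dotProduct_smul, hhop' z, hint z, smul_eq_mul, smul_eq_mul,
      smul_eq_mul, Complex.add_re, Complex.sub_re, Complex.re_ofReal_mul, Complex.re_ofReal_mul,
      Complex.re_ofReal_mul, Complex.neg_re, Complex.re_sum, Complex.sub_re]
    simp only [hw, hb, hq]
    ring
  -- the hopping part, pointwise
  have hX : ∀ z, t * ∑ y ∈ F z, (star (c y) ⬝ᵥ c z).re ≤
      |t| * ((∑ _y ∈ F z, a z) + ∑ y ∈ F z, a y) / 2 := by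
    intro z
    calc t * ∑ y ∈ F z, (star (c y) ⬝ᵥ c z).re
        ≤ |t * ∑ y ∈ F z, (star (c y) ⬝ᵥ c z).re| := le_abs_self _
      _ = |t| * |∑ y ∈ F z, (star (c y) ⬝ᵥ c z).re| := abs_mul _ _
      _ ≤ |t| * ∑ y ∈ F z, |(star (c y) ⬝ᵥ c z).re| :=
          mul_le_mul_of_nonneg_left (Finset.abs_sum_le_sum_abs _ _) (abs_nonneg t)
      _ ≤ |t| * ∑ y ∈ F z, (a z + a y) / 2 := by
          refine mul_le_mul_of_nonneg_left (Finset.sum_le_sum fun y _ => ?_) (abs_nonneg t)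
          have := two_mul_abs_re_dot_le (c y) (c z)
          simp only [ha]
          linarith
      _ = |t| * ((∑ _y ∈ F z, a z) + ∑ y ∈ F z, a y) / 2 := by
          rw [← Finset.sum_add_distrib, ← Finset.sum_div, mul_div_assoc]
  -- degree counting
  have hdeg1 : ∑ z, ∑ _y ∈ F z, a z ≤ Δ * ∑ z, a z := by
    rw [Finset.mul_sum]
    refine Finset.sum_le_sum fun z _ => ?_
    rw [Finset.sum_const, nsmul_eq_mul]
    exact mul_le_mul_of_nonneg_right (by exact_mod_cast hΔ z) (ha0 z)
  have hdeg2 : ∑ z, ∑ y ∈ F z, a y ≤ Δ * ∑ y, a y := by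
    calc ∑ z, ∑ y ∈ F z, a y
        = ∑ z, ∑ y, if G.Adj z y then a y else 0 := by
          refine Finset.sum_congr rfl fun z _ => ?_
          rw [hF, Finset.sum_filter]
      _ = ∑ y, ∑ z, if G.Adj z y then a y else 0 := Finset.sum_comm
      _ = ∑ y, ((Finset.univ.filter fun z => G.Adj z y).card : ℝ) * a y := by
          refine Finset.sum_congr rfl fun y _ => ?_
          rw [← Finset.sum_filter, Finset.sum_const, nsmul_eq_mul]
      _ ≤ ∑ y, (Δ : ℝ) * a y := by
          refine Finset.sum_le_sum fun y _ => mul_le_mul_of_nonneg_right ?_ (ha0 y)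
          have hsymm : (Finset.univ.filter fun z => G.Adj z y) =
              Finset.univ.filter fun z => G.Adj y z := by
            refine Finset.filter_congr fun z _ => ?_
            exact G.adj_comm _ _
          rw [hsymm]
          exact_mod_cast hΔ y
      _ = Δ * ∑ y, a y := by rw [Finset.mul_sum]
  -- assemble
  calc ∑ z, (expect (hamiltonian G t U) (d z)).re
      = ∑ z, (E * w z + t * ∑ y ∈ F z, (star (c y) ⬝ᵥ c z).re + U * (b z - q z)) :=
        Finset.sum_congr rfl fun z _ => hpt z
    _ ≤ ∑ z, (E * w z + |t| * ((∑ _y ∈ F z, a z) + ∑ y ∈ F z, a y) / 2 + U * b z) := by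
        refine Finset.sum_le_sum fun z _ => ?_
        have h1 := hX z
        have h2 : 0 ≤ U * q z := mul_nonneg hU (hq0 z)
        have h3 : U * (b z - q z) = U * b z - U * q z := mul_sub U (b z) (q z)
        linarith
    _ = E * ∑ z, w z + |t| * ((∑ z, ∑ _y ∈ F z, a z) + ∑ z, ∑ y ∈ F z, a y) / 2 +
          U * ∑ z, b z := by
        rw [Finset.sum_add_distrib, Finset.sum_add_distrib, ← Finset.mul_sum, ← Finset.mul_sum,
          ← Finset.sum_div, ← Finset.mul_sum, Finset.sum_add_distrib]
    _ ≤ E * ∑ z, w z + |t| * ((Δ * ∑ z, a z) + Δ * ∑ z, a z) / 2 + U * ∑ z, b z := by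
        have ht : 0 ≤ |t| := abs_nonneg t
        nlinarith [hdeg1, hdeg2, ht]
    _ = E * ∑ z, w z + Δ * |t| * ∑ z, a z + U * ∑ z, b z := by ring

/-- **One-particle addition**: with the hypotheses of `sum_re_expect_creation_le`, if a number
`E'` satisfies the homogeneous variational bound `E' ‖c†_{zτ}φ‖² ≤ Re ⟨c†_{zτ}φ, H c†_{zτ}φ⟩` for
every `z` (e.g. the sector energy of the sector containing the `c†_{zτ}φ`), and
`A = Σ_z ‖c†_{zτ}φ‖² > 0`, `B = Σ_z ‖c_{zτ}φ‖²`, `C = Σ_z ‖c_{zτ̄}φ‖²`, then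
`E' ≤ E + (Δ|t| B + U C)/A`. Tasaki (2020) §2.1; Ruelle (1969) §3.4 (the classical analogue).
[folklore] -/
theorem le_of_addition_bound {Δ : ℕ}
    (hΔ : ∀ x : Λ, (Finset.univ.filter fun y => G.Adj x y).card ≤ Δ) (t : ℝ) {U : ℝ} (hU : 0 ≤ U)
    {τ τ' : Fin 2} (hne : τ' ≠ τ) {E : ℝ} {φ : Fock (Orb Λ)}
    (hφ : hamiltonian G t U *ᵥ φ = (E : ℂ) • φ) {E' : ℝ}
    (hvar : ∀ z : Λ,
      E' * (star (creation (orb z τ) *ᵥ φ) ⬝ᵥ (creation (orb z τ) *ᵥ φ)).re ≤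
        (expect (hamiltonian G t U) (creation (orb z τ) *ᵥ φ)).re)
    {A B C : ℝ}
    (hA : ∑ z : Λ, (star (creation (orb z τ) *ᵥ φ) ⬝ᵥ (creation (orb z τ) *ᵥ φ)).re = A)
    (hB : ∑ z : Λ, (star (annihilation (orb z τ) *ᵥ φ) ⬝ᵥ (annihilation (orb z τ) *ᵥ φ)).re = B)
    (hC : ∑ z : Λ,
      (star (annihilation (orb z τ') *ᵥ φ) ⬝ᵥ (annihilation (orb z τ') *ᵥ φ)).re = C)
    (hApos : 0 < A) :
    E' ≤ E + (Δ * |t| * B + U * C) / A := by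
  have h1 : E' * A ≤ ∑ z : Λ, (expect (hamiltonian G t U) (creation (orb z τ) *ᵥ φ)).re := by
    rw [← hA, Finset.mul_sum]
    exact Finset.sum_le_sum fun z _ => hvar z
  have h2 := sum_re_expect_creation_le G hΔ t hU hne hφ
  rw [hA, hB, hC] at h2
  rw [add_div' _ _ _ hApos.ne', le_div_iff₀ hApos]
  linarith

end Addition

/-! ### The torus `(ℤ/Lℤ)²`: the registered stub -/

section Torus

/-- **Stub `stub_pairAdditionBound`** of line `SketchIdeator4` (Euler ADDITION bound, the mirror
image of the tree's `EnslavedA1g.minEnergyOn_pairRemoved_le`). For `U ≥ 0` and `2n + 2 ≤ L²`, with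
`E(N, 0) = minEnergyOn (hubbardTorus 2 L 1 U) (szSector N 0)`:
`E(2n+2, 0) ≤ E(2n, 0) + (8n + U(2n+1)) / (L² - n)`.
Add an `↑` electron to a ground state `φ₀` of the sector `(n, n)`, averaged over all sites
(`Σ_z ‖c†_{z↑}φ₀‖² = (L² - n)‖φ₀‖²`, `Σ_z ‖c_{z↑}φ₀‖² = Σ_z ‖c_{z↓}φ₀‖² = n‖φ₀‖²`, degree `4`,
`t = 1`; `le_of_addition_bound`): `E(n+1, n) ≤ E(2n, 0) + (4n + Un)/(L² - n)`; then a `↓`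
electron to a ground state `φ₁` of the sector `(n+1, n)` (`Σ_z ‖c†_{z↓}φ₁‖² = (L² - n)‖φ₁‖²`,
`Σ_z ‖c_{z↓}φ₁‖² = n‖φ₁‖²`, `Σ_z ‖c_{z↑}φ₁‖² = (n+1)‖φ₁‖²`):
`E(2n+2, 0) ≤ E(n+1, n) + (4n + U(n+1))/(L² - n)`. The sector ground states and variational bounds
are the tree's `szSector_groundState` / `upDownSector_groundState`. Tasaki (2020) §2.1
(variational principle); folklore (the Euler identity
`Σ_z c_{zσ}[H, c†_{zσ}] = -T_σ + U Σ_z n_{zσ̄}(1 - n_{zσ})`). [folklore] -/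
theorem stub_pairAdditionBound : ∀ (U : ℝ), 0 ≤ U → ∀ (L : ℕ) [NeZero L] (n : ℕ),
    2 * n + 2 ≤ L ^ 2 →
    (hubbardTorus 2 L 1 U).minEnergyOn (szSector (2 * (n + 1)) 0) ≤
      (hubbardTorus 2 L 1 U).minEnergyOn (szSector (2 * n) 0) +
        (8 * n + U * (2 * n + 1)) / ((L : ℝ) ^ 2 - n) := by
  intro U hU L _ n hn
  have hcard : Fintype.card (FermionTorus 2 L) = L ^ 2 := card_fermionTorus 2 L
  have hn0 : n ≤ Fintype.card (FermionTorus 2 L) := by rw [hcard]; omega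
  have hn1 : n + 1 ≤ Fintype.card (FermionTorus 2 L) := by rw [hcard]; omega
  set H := hubbardTorus 2 L 1 U with hH
  have hHG : H = hamiltonian (fermionTorusGraph 2 L) 1 U := rfl
  have hΔ : ∀ x : FermionTorus 2 L,
      (Finset.univ.filter fun y => (fermionTorusGraph 2 L).Adj x y).card ≤ 4 := fun x =>
    (SourceGas.card_filter_fermionTorusGraph_adj_le x).trans (by norm_num)
  have h10 : (1 : Fin 2) ≠ 0 := by decide
  have h01 : (0 : Fin 2) ≠ 1 := by decide
  have hLn : (0 : ℝ) < (L : ℝ) ^ 2 - n := by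
    have : ((2 * n + 2 : ℕ) : ℝ) ≤ ((L ^ 2 : ℕ) : ℝ) := by exact_mod_cast hn
    push_cast at this
    linarith
  have hcastC : ((Fintype.card (FermionTorus 2 L) : ℕ) : ℂ) - ((n : ℕ) : ℂ) =
      (((L : ℝ) ^ 2 - n : ℝ) : ℂ) := by
    rw [hcard]; push_cast; ring
  -- the two sector ground states: `φ₀` in `(n, n)`, `φ₁` in `(n+1, n)`
  obtain ⟨⟨φ₀, hφ₀S, hφ₀0, hHφ₀⟩, -⟩ := szSector_groundState (fermionTorusGraph 2 L) 1 U hn0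
  have hsec₀ : IsInSector n n φ₀ := (mem_szSector_two_mul_zero_iff n φ₀).1 hφ₀S
  obtain ⟨⟨φ₁, hsec₁, hφ₁0, hHφ₁⟩, hvar₁⟩ :=
    upDownSector_groundState (fermionTorusGraph 2 L) 1 U (a := n + 1) (b := n) hn1 hn0
  have hvar₂ := (szSector_groundState (fermionTorusGraph 2 L) 1 U hn1).2
  have hr₀ : 0 < (star φ₀ ⬝ᵥ φ₀).re := re_star_dotProduct_self_pos hφ₀0
  have hr₁ : 0 < (star φ₁ ⬝ᵥ φ₁).re := re_star_dotProduct_self_pos hφ₁0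
  -- step 1: add an `↑` electron to `φ₀` (`τ = 0`, `τ' = 1`)
  have hA₀ : ∑ z : FermionTorus 2 L,
      (star (creation (orb z 0) *ᵥ φ₀) ⬝ᵥ (creation (orb z 0) *ᵥ φ₀)).re =
        ((L : ℝ) ^ 2 - n) * (star φ₀ ⬝ᵥ φ₀).re := by
    rw [← Complex.re_sum, sum_norm_creation_mulVec, sum_numberOp_up_mulVec hsec₀, dotProduct_smul,
      smul_eq_mul, ← sub_mul, hcastC, Complex.re_ofReal_mul]
  have hB₀ : ∑ z : FermionTorus 2 L,
      (star (annihilation (orb z 0) *ᵥ φ₀) ⬝ᵥ (annihilation (orb z 0) *ᵥ φ₀)).re =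
        (n : ℝ) * (star φ₀ ⬝ᵥ φ₀).re := by
    rw [← Complex.re_sum, sum_norm_annihilation_mulVec, sum_numberOp_up_mulVec hsec₀,
      dotProduct_smul, smul_eq_mul, ← Complex.ofReal_natCast, Complex.re_ofReal_mul]
  have hC₀ : ∑ z : FermionTorus 2 L,
      (star (annihilation (orb z 1) *ᵥ φ₀) ⬝ᵥ (annihilation (orb z 1) *ᵥ φ₀)).re =
        (n : ℝ) * (star φ₀ ⬝ᵥ φ₀).re := by
    rw [← Complex.re_sum, sum_norm_annihilation_mulVec, sum_numberOp_down_mulVec hsec₀,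
      dotProduct_smul, smul_eq_mul, ← Complex.ofReal_natCast, Complex.re_ofReal_mul]
  have h1 := le_of_addition_bound (fermionTorusGraph 2 L) hΔ 1 hU h10 hHφ₀
    (fun z => hvar₁ _ (hsec₀.creation_up_mulVec z)) hA₀ hB₀ hC₀ (mul_pos hLn hr₀)
  have h1' : (4 : ℕ) * |(1 : ℝ)| * ((n : ℝ) * (star φ₀ ⬝ᵥ φ₀).re) +
      U * ((n : ℝ) * (star φ₀ ⬝ᵥ φ₀).re) =
        (4 * n + U * n) * (star φ₀ ⬝ᵥ φ₀).re := by
    rw [abs_one]; push_cast; ring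
  rw [h1', mul_div_mul_right _ _ hr₀.ne'] at h1
  -- step 2: add a `↓` electron to `φ₁` (`τ = 1`, `τ' = 0`)
  have hA₁ : ∑ z : FermionTorus 2 L,
      (star (creation (orb z 1) *ᵥ φ₁) ⬝ᵥ (creation (orb z 1) *ᵥ φ₁)).re =
        ((L : ℝ) ^ 2 - n) * (star φ₁ ⬝ᵥ φ₁).re := by
    rw [← Complex.re_sum, sum_norm_creation_mulVec, sum_numberOp_down_mulVec hsec₁, dotProduct_smul,
      smul_eq_mul, ← sub_mul, hcastC, Complex.re_ofReal_mul]
  have hB₁ : ∑ z : FermionTorus 2 L,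
      (star (annihilation (orb z 1) *ᵥ φ₁) ⬝ᵥ (annihilation (orb z 1) *ᵥ φ₁)).re =
        (n : ℝ) * (star φ₁ ⬝ᵥ φ₁).re := by
    rw [← Complex.re_sum, sum_norm_annihilation_mulVec, sum_numberOp_down_mulVec hsec₁,
      dotProduct_smul, smul_eq_mul, ← Complex.ofReal_natCast, Complex.re_ofReal_mul]
  have hC₁ : ∑ z : FermionTorus 2 L,
      (star (annihilation (orb z 0) *ᵥ φ₁) ⬝ᵥ (annihilation (orb z 0) *ᵥ φ₁)).re =
        ((n : ℝ) + 1) * (star φ₁ ⬝ᵥ φ₁).re := by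
    rw [← Complex.re_sum, sum_norm_annihilation_mulVec, sum_numberOp_up_mulVec hsec₁,
      dotProduct_smul, smul_eq_mul, ← Complex.ofReal_natCast, Complex.re_ofReal_mul]
    push_cast
    ring
  have h2 := le_of_addition_bound (fermionTorusGraph 2 L) hΔ 1 hU h01 hHφ₁
    (fun z => hvar₂ _ (hsec₁.creation_down_mulVec z)) hA₁ hB₁ hC₁ (mul_pos hLn hr₁)
  have h2' : (4 : ℕ) * |(1 : ℝ)| * ((n : ℝ) * (star φ₁ ⬝ᵥ φ₁).re) +
      U * (((n : ℝ) + 1) * (star φ₁ ⬝ᵥ φ₁).re) =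
        (4 * n + U * (n + 1)) * (star φ₁ ⬝ᵥ φ₁).re := by
    rw [abs_one]; push_cast; ring
  rw [h2', mul_div_mul_right _ _ hr₁.ne'] at h2
  -- add the two steps
  rw [← hHG] at h1 h2
  have hsum : (4 * n + U * n) / ((L : ℝ) ^ 2 - n) + (4 * n + U * (n + 1)) / ((L : ℝ) ^ 2 - n) =
      (8 * n + U * (2 * n + 1)) / ((L : ℝ) ^ 2 - n) := by
    rw [← add_div]; congr 1; ring
  linarith

end Torus

end Summit.HubbardSuperconductivity.HubbardSuperconductivity.Theorems.FunctionFieldCertificate
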